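import Mathlib
import Literature.Combinatorics.Additive.BorderTricoloredSumFree
import Literature.Computability.AlgebraicComplexity.XyzFreeDiagonal
import Summits.MatrixMultiplication.MatrixMultiplication.Theorems.SoloInformedCwTwoMonomialDoor

/-!
# Designs of `S_N` and free diagonals give border tricolored sum-free sets

Solo seat `solo-MatrixMultiplication-informed`, gen 9; first half of the bounded-exponent closure of
door D6 (`SoloInformedCwTwoBoundedExponent.lean`). A weighted digit design `(f, a)` of `S_N` in `B`
(the hypothesis of `matrixMultiplication_of_weighted_designs`, here `IsDoorDesign`) makes `S_N` a
combinatorial degeneration of its relation set; combined with a FREE DIAGONAL of `S_{M' × N}`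
(`IsXyzFreeDiagonal`; their existence in size `(3-η)^k` is Strassen's theorem, the Literature fact
`XyzFreeDiagonalHypothesis`) the blockwise sums and weights form a border tricolored sum-free set
in `B^{M'}` (`isBorderTricoloredSumFree_of_design`, BCCGNSU Def. 3.2) with weights bounded by
`4 M' W₀` (`abs_blockWt_weight_le`).

References: BCCGNSU 2017 (arXiv:1605.06702) Def. 3.1/3.2; V. Strassen, J. reine angew. Math. 413
(1991); Christandl–Vrana–Zuiddam, arXiv:1709.07851 §4.1.
-/

open scoped BigOperators
open Filter Topology

namespace Summit.MatrixMultiplication.MatrixMultiplication.Theorems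

open Literature.Combinatorics.Additive Literature.Computability.AlgebraicComplexity

/-! ## Free diagonals of `S_K` and Strassen's hypothesis -/

section FreeDiagonal

variable {K : Type*}

/-- A triple of words over the coordinate set `K` is TRANSVERSAL (lies in `S_K`) when its three
letters are pairwise distinct in every coordinate. [folklore] -/
def IsXyzTransversal (u v w : K → Fin 3) : Prop := ∀ k, u k ≠ v k ∧ u k ≠ w k ∧ v k ≠ w k

/-- A FREE DIAGONAL of `S_K` (Strassen 1991; Christandl–Vrana–Zuiddam 2018, before Thm. 4.4): a
finite family `D` of transversal triples such that the only transversal triple `(x₁, y₂, z₃)` with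
`x, y, z ∈ D` is a member of `D` read three times (`x = y = z`). (This single condition contains
both "the coordinates determine the element" and `S_K ∩ (D₁ × D₂ × D₃) = D`.)
[cite: ChristandlVranaZuiddam2023, §4.1 (free diagonal, arXiv numbering)] -/
def IsXyzFreeDiagonal (D : Finset ((K → Fin 3) × (K → Fin 3) × (K → Fin 3))) : Prop :=
  (∀ x ∈ D, IsXyzTransversal x.1 x.2.1 x.2.2) ∧
    ∀ x ∈ D, ∀ y ∈ D, ∀ z ∈ D, IsXyzTransversal x.1 y.2.1 z.2.2 → x = y ∧ y = z

/-- The hypothesis says exactly: large `S_K` have free diagonals (`IsXyzFreeDiagonal`) of size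
`≥ (3-η)^{|K|}`. [cite: ChristandlVranaZuiddam2023, Thm. 4.4 (arXiv numbering)] -/
theorem xyzFreeDiagonalHypothesis_iff : XyzFreeDiagonalHypothesis ↔
    ∀ η : ℝ, 0 < η → η < 1 → ∃ k₀ : ℕ, ∀ (K : Type) [Fintype K] [DecidableEq K],
      k₀ ≤ Fintype.card K →
        ∃ D : Finset ((K → Fin 3) × (K → Fin 3) × (K → Fin 3)),
          IsXyzFreeDiagonal D ∧ (3 - η) ^ Fintype.card K ≤ (D.card : ℝ) := by
  simp only [XyzFreeDiagonalHypothesis, IsXyzFreeDiagonal, IsXyzTransversal, and_assoc]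

end FreeDiagonal

/-! ## Designs (the door's hypothesis, verbatim) and their block powers -/

section Design

variable {B : Type*} [AddCommGroup B] {N : ℕ}

/-- The weighted-design property of the door `matrixMultiplication_of_weighted_designs`, verbatim:
every relation `P(u)+P(v)+P(w) = σ` is transversal or has total weight `> W₀`.
[cite: AlmanVassilevskaWilliams2018, Thm. 7.2] -/
def IsDoorDesign (f : Fin N → Fin 3 → B) (a : Fin N → Fin 3 → ℕ) : Prop :=
  ∀ u v w : Fin N → Fin 3,
    wordSum f u + wordSum f v + wordSum f w = ∑ k, (f k 0 + f k 1 + f k 2) →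
      (∀ k, u k ≠ v k ∧ u k ≠ w k ∧ v k ≠ w k) ∨
        ∑ k, (a k 0 + a k 1 + a k 2) < wordWt a u + wordWt a v + wordWt a w

/-- A single digit weight is at most the coordinate total `a k 0 + a k 1 + a k 2`. [folklore] -/
theorem apply_le_sum_three (g : Fin 3 → ℕ) (x : Fin 3) : g x ≤ g 0 + g 1 + g 2 :=
  calc g x ≤ ∑ y, g y := Finset.single_le_sum (fun _ _ => Nat.zero_le _) (Finset.mem_univ x)
    _ = g 0 + g 1 + g 2 := Fin.sum_univ_three g

/-- Word weights are bounded by `W₀ = ∑ₖ (a k 0 + a k 1 + a k 2)`. [folklore] -/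
theorem wordWt_le (a : Fin N → Fin 3 → ℕ) (u : Fin N → Fin 3) :
    wordWt a u ≤ ∑ k, (a k 0 + a k 1 + a k 2) :=
  Finset.sum_le_sum fun k _ => apply_le_sum_three (a k) (u k)

/-- On a transversal triple the three weights add up to `W₀`. [folklore] -/
theorem wordWt_add_of_distinct (a : Fin N → Fin 3 → ℕ) {u v w : Fin N → Fin 3}
    (h : ∀ k, u k ≠ v k ∧ u k ≠ w k ∧ v k ≠ w k) :
    wordWt a u + wordWt a v + wordWt a w = ∑ k, (a k 0 + a k 1 + a k 2) :=
  wordSum_add_of_distinct a h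

/-- In a design, every relation has total weight `≥ W₀`. [cite: AlmanVassilevskaWilliams2018, Thm. 7.2] -/
theorem IsDoorDesign.le_wordWt_add {f : Fin N → Fin 3 → B} {a : Fin N → Fin 3 → ℕ}
    (hdes : IsDoorDesign f a) {u v w : Fin N → Fin 3}
    (hrel : wordSum f u + wordSum f v + wordSum f w = ∑ k, (f k 0 + f k 1 + f k 2)) :
    ∑ k, (a k 0 + a k 1 + a k 2) ≤ wordWt a u + wordWt a v + wordWt a w := by
  rcases hdes u v w hrel with h | h
  · exact (wordWt_add_of_distinct a h).ge
  · exact h.le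

/-- In a design, a relation of total weight exactly `W₀` is transversal.
[cite: AlmanVassilevskaWilliams2018, Thm. 7.2] -/
theorem IsDoorDesign.distinct_of_wordWt_add_eq {f : Fin N → Fin 3 → B} {a : Fin N → Fin 3 → ℕ}
    (hdes : IsDoorDesign f a) {u v w : Fin N → Fin 3}
    (hrel : wordSum f u + wordSum f v + wordSum f w = ∑ k, (f k 0 + f k 1 + f k 2))
    (hwt : wordWt a u + wordWt a v + wordWt a w = ∑ k, (a k 0 + a k 1 + a k 2)) :
    ∀ k, u k ≠ v k ∧ u k ≠ w k ∧ v k ≠ w k := by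
  rcases hdes u v w hrel with h | h
  · exact h
  · omega

variable {M' : ℕ}

/-- Block `j` of a word over `Fin M' × Fin N`. [folklore] -/
def block (U : Fin M' × Fin N → Fin 3) (j : Fin M') : Fin N → Fin 3 := fun n => U (j, n)

/-- Blockwise word sums `P'(U) = (P(U_j))_j ∈ B^{M'}`. [folklore] -/
def blockSum (f : Fin N → Fin 3 → B) (U : Fin M' × Fin N → Fin 3) : Fin M' → B :=
  fun j => wordSum f (block U j)

/-- Total weight of a word over `Fin M' × Fin N`: the sum of its block weights. [folklore] -/
def blockWt (a : Fin N → Fin 3 → ℕ) (U : Fin M' × Fin N → Fin 3) : ℕ :=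
  ∑ j, wordWt a (block U j)

/-- The total weight is at most `M' · W₀`. [folklore] -/
theorem blockWt_le (a : Fin N → Fin 3 → ℕ) (U : Fin M' × Fin N → Fin 3) :
    blockWt a U ≤ M' * ∑ k, (a k 0 + a k 1 + a k 2) := by
  unfold blockWt
  calc ∑ j, wordWt a (block U j) ≤ ∑ _j : Fin M', ∑ k, (a k 0 + a k 1 + a k 2) :=
        Finset.sum_le_sum fun j _ => wordWt_le a _
    _ = M' * ∑ k, (a k 0 + a k 1 + a k 2) := by simp

/-- A triple of words over `Fin M' × Fin N` is transversal iff every block is. [folklore] -/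
theorem isXyzTransversal_iff_block (U V W : Fin M' × Fin N → Fin 3) :
    IsXyzTransversal U V W ↔
      ∀ j, ∀ n, block U j n ≠ block V j n ∧ block U j n ≠ block W j n ∧
        block V j n ≠ block W j n :=
  ⟨fun h j n => h (j, n), fun h k => h k.1 k.2⟩

end Design

/-! ## From a design and a free diagonal to a border tricolored sum-free set -/

section Border

variable {B : Type*} [AddCommGroup B] {N M' : ℕ}

/-- **Design + free diagonal ⟹ border tricolored sum-free set** (the combinatorial-degeneration
step of the bounded-exponent closure): for a design `(f, a)` of `S_N` in `B` and a free diagonal `D`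
of `S_{M' × N}`, the blockwise sums `P'(x₁), P'(x₂), P'(x₃) - σ'` with the weights
`3·wt'(xᵢ) - M'W₀` form a border tricolored sum-free set in `B^{M'}` indexed by `D`
(BCCGNSU Def. 3.2, tree `IsBorderTricoloredSumFree`).
[cite: BlasiakChurchCohnGrochowNaslundSawinUmans2017, Def. 3.2] -/
theorem isBorderTricoloredSumFree_of_design {f : Fin N → Fin 3 → B} {a : Fin N → Fin 3 → ℕ}
    (hdes : IsDoorDesign f a)
    {D : Finset ((Fin M' × Fin N → Fin 3) × (Fin M' × Fin N → Fin 3) × (Fin M' × Fin N → Fin 3))}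
    (hD : IsXyzFreeDiagonal D) :
    IsBorderTricoloredSumFree (H := Fin M' → B) (ι := D)
      (fun x => blockSum f x.1.1) (fun x => blockSum f x.1.2.1)
      (fun x => blockSum f x.1.2.2 - fun _ => ∑ k, (f k 0 + f k 1 + f k 2))
      (fun x => 3 * (blockWt a x.1.1 : ℤ) - M' * (∑ k, (a k 0 + a k 1 + a k 2) : ℕ))
      (fun x => 3 * (blockWt a x.1.2.1 : ℤ) - M' * (∑ k, (a k 0 + a k 1 + a k 2) : ℕ))
      (fun x => 3 * (blockWt a x.1.2.2 : ℤ) - M' * (∑ k, (a k 0 + a k 1 + a k 2) : ℕ)) := by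
  classical
  set σ : B := ∑ k, (f k 0 + f k 1 + f k 2) with hσ
  set W₀ : ℕ := ∑ k, (a k 0 + a k 1 + a k 2) with hW₀
  -- a relation in `B^{M'}` is a relation in every block
  have hrel : ∀ U V W : Fin M' × Fin N → Fin 3,
      blockSum f U + blockSum f V + (blockSum f W - fun _ => σ) = 0 ↔
        ∀ j, wordSum f (block U j) + wordSum f (block V j) + wordSum f (block W j) = σ := by
    intro U V W
    rw [funext_iff]
    refine forall_congr' fun j => ?_
    simp only [blockSum, Pi.add_apply, Pi.sub_apply, Pi.zero_apply]
    constructor <;> intro h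
    · rw [← sub_eq_zero, ← h]; abel
    · rw [← h]; abel
  -- in a design every block relation has block weight `≥ W₀`
  have hge : ∀ U V W : Fin M' × Fin N → Fin 3,
      (∀ j, wordSum f (block U j) + wordSum f (block V j) + wordSum f (block W j) = σ) →
        ∀ j, W₀ ≤ wordWt a (block U j) + wordWt a (block V j) + wordWt a (block W j) :=
    fun U V W h j => hdes.le_wordWt_add (h j)
  have hsum3 : ∀ U V W : Fin M' × Fin N → Fin 3,
      (blockWt a U : ℤ) + blockWt a V + blockWt a W =
        ∑ j, ((wordWt a (block U j) + wordWt a (block V j) + wordWt a (block W j) : ℕ) : ℤ) := by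
    intro U V W
    unfold blockWt
    push_cast
    rw [Finset.sum_add_distrib, Finset.sum_add_distrib]
  refine ⟨fun x => ⟨?_, ?_⟩, fun x y z h0 => ?_, fun x y z h0 hw => ?_⟩
  · -- matched triples are relations (blockwise transversal)
    rw [hrel]
    intro j
    exact wordSum_add_of_distinct f fun n => (hD.1 x.1 x.2) (j, n)
  · -- matched weights vanish
    have hx : ∀ j, wordWt a (block x.1.1 j) + wordWt a (block x.1.2.1 j) +
        wordWt a (block x.1.2.2 j) = W₀ :=
      fun j => wordWt_add_of_distinct a fun n => (hD.1 x.1 x.2) (j, n)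
    have : (blockWt a x.1.1 : ℤ) + blockWt a x.1.2.1 + blockWt a x.1.2.2 = M' * (W₀ : ℤ) := by
      rw [hsum3]; simp [hx]
    linear_combination 3 * this
  · -- relations have nonnegative weight
    have h1 := hge _ _ _ ((hrel _ _ _).1 h0)
    have : M' * (W₀ : ℤ) ≤ (blockWt a x.1.1 : ℤ) + blockWt a y.1.2.1 + blockWt a z.1.2.2 := by
      rw [hsum3]
      calc (M' : ℤ) * W₀ = ∑ _j : Fin M', (W₀ : ℤ) := by simp
        _ ≤ _ := Finset.sum_le_sum fun j _ => by exact_mod_cast h1 j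
    linarith
  · -- weight zero forces every block to be transversal, hence the triple lies on the diagonal
    have hr := (hrel _ _ _).1 h0
    have h1 := hge _ _ _ hr
    have htot : ∑ j, ((wordWt a (block x.1.1 j) + wordWt a (block y.1.2.1 j) +
        wordWt a (block z.1.2.2 j) : ℕ) : ℤ) = ∑ _j : Fin M', (W₀ : ℤ) := by
      have : (blockWt a x.1.1 : ℤ) + blockWt a y.1.2.1 + blockWt a z.1.2.2 = M' * (W₀ : ℤ) := by
        linarith
      rw [hsum3] at this
      rw [this]; simp
    have heach : ∀ j ∈ (Finset.univ : Finset (Fin M')),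
        ((wordWt a (block x.1.1 j) + wordWt a (block y.1.2.1 j) +
          wordWt a (block z.1.2.2 j) : ℕ) : ℤ) = W₀ := by
      have hle : ∀ j ∈ (Finset.univ : Finset (Fin M')), (W₀ : ℤ) ≤
          ((wordWt a (block x.1.1 j) + wordWt a (block y.1.2.1 j) +
            wordWt a (block z.1.2.2 j) : ℕ) : ℤ) := fun j _ => by exact_mod_cast h1 j
      exact fun j hj => ((Finset.sum_eq_sum_iff_of_le hle).1 htot.symm j hj).symm
    have htr : IsXyzTransversal x.1.1 y.1.2.1 z.1.2.2 := by
      rw [isXyzTransversal_iff_block]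
      intro j
      exact hdes.distinct_of_wordWt_add_eq (hr j)
        (by exact_mod_cast heach j (Finset.mem_univ j))
    obtain ⟨hxy, hyz⟩ := hD.2 x.1 x.2 y.1 y.2 z.1 z.2 htr
    exact ⟨Subtype.ext hxy, Subtype.ext hyz⟩

/-- The weights of `isBorderTricoloredSumFree_of_design` are bounded by `R = 4 M' W₀`. [folklore] -/
theorem abs_blockWt_weight_le (a : Fin N → Fin 3 → ℕ) (U : Fin M' × Fin N → Fin 3) :
    |3 * (blockWt a U : ℤ) - M' * (∑ k, (a k 0 + a k 1 + a k 2) : ℕ)| ≤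
      (4 * M' * ∑ k, (a k 0 + a k 1 + a k 2) : ℕ) := by
  have h := blockWt_le a U (M' := M')
  have h0 : (0 : ℤ) ≤ blockWt a U := by positivity
  have h' : (blockWt a U : ℤ) ≤ M' * (∑ k, (a k 0 + a k 1 + a k 2) : ℕ) := by exact_mod_cast h
  have hm : (0 : ℤ) ≤ (M' : ℤ) * ((∑ k, (a k 0 + a k 1 + a k 2) : ℕ) : ℤ) := by positivity
  rw [abs_le]
  push_cast at h' hm ⊢
  constructor <;> linarith

end Border

end Summit.MatrixMultiplication.MatrixMultiplication.Theorems
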